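import Literature.NumberTheory.Irrationality.Zudilin2014.SecondTale

/-!
# Congruences modulo `p` on `ℚ` — toolkit for the top window of the second tale (fam-denom)

HONEST FRAMING: systematic search; no irrationality claim unless certified.  Cell `pub-zeta5`,
DENOMINATOR ARITHMETIC lane (`families/denom/P15KERNEL.md` §10.9, THEOREM W).  This file is pure
`p`-adic bookkeeping of rational numbers; it says nothing about irrationality.

`EqModP p x y` is the congruence `x ≡ y (mod p ℤ_(p))` on `ℚ`, i.e. `‖x − y‖_p ≤ p⁻¹`.  It is an
equivalence relation compatible with sums, differences and multiplication by `p`-integral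
rationals.  The **key lemma** `padicNorm_sum_mul_sub_le_one` is the only way the congruence is
consumed downstream: if `‖B_j‖_p ≤ p` and `w_j ≡ w'_j (mod p)` for every `j`, then
`Σ_j B_j w_j − Σ_j B_j w'_j` is `p`-integral (the coefficients `B_k` of [Zudilin 2014, §6] have
`ord_p B_k ≥ −1`, so weights congruent mod `p` may be exchanged under `Σ_k B_k ·` at integral cost).
Unit shifts: `1/(p + e) ≡ 1/e` for an integer `e` prime to `p`, and `2/(p + 2d) ≡ 1/d` for
`0 < |d| < p` (`p` odd) — the half-integer evaluation points `t_k = p/2 − k` of the window argument.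
-/

namespace Summit.KontsevichZagierPeriods.Zeta5Search.Denom.WindowModP

open Finset

variable {p : ℕ}

/-- `EqModP p x y` : `x ≡ y (mod p ℤ_(p))`, i.e. `‖x − y‖_p ≤ p⁻¹`. -/
def EqModP (p : ℕ) (x y : ℚ) : Prop := padicNorm p (x - y) ≤ (p : ℚ)⁻¹

/-- Reflexivity of `≡ (mod p)`. -/
theorem EqModP.refl (x : ℚ) : EqModP p x x := by
  simp only [EqModP, sub_self, padicNorm.zero]; positivity

/-- Symmetry of `≡ (mod p)`. -/
theorem EqModP.symm {x y : ℚ} (h : EqModP p x y) : EqModP p y x := by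
  unfold EqModP at *; rwa [← neg_sub, padicNorm.neg]

/-- `≡ (mod p)` respects negation. -/
theorem EqModP.neg {x y : ℚ} (h : EqModP p x y) : EqModP p (-x) (-y) := by
  unfold EqModP at *
  have e : -x - -y = -(x - y) := by ring
  rwa [e, padicNorm.neg]

/-- Transport of a congruence along equalities of its two sides. -/
theorem EqModP.congr {x y x' y' : ℚ} (h : EqModP p x y) (hx : x = x') (hy : y = y') : EqModP p x' y' :=
  hx ▸ hy ▸ h

variable [hp : Fact p.Prime]

/-- Transitivity of `≡ (mod p)`. -/
theorem EqModP.trans {x y z : ℚ} (h₁ : EqModP p x y) (h₂ : EqModP p y z) : EqModP p x z := by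
  unfold EqModP at *
  have e : x - z = (x - y) + (y - z) := by ring
  rw [e]; exact le_trans (padicNorm.nonarchimedean) (max_le h₁ h₂)

/-- `≡ (mod p)` is additive. -/
theorem EqModP.add {x y x' y' : ℚ} (h₁ : EqModP p x y) (h₂ : EqModP p x' y') :
    EqModP p (x + x') (y + y') := by
  unfold EqModP at *
  have e : x + x' - (y + y') = (x - y) + (x' - y') := by ring
  rw [e]; exact le_trans (padicNorm.nonarchimedean) (max_le h₁ h₂)

/-- `≡ (mod p)` respects subtraction. -/
theorem EqModP.sub {x y x' y' : ℚ} (h₁ : EqModP p x y) (h₂ : EqModP p x' y') :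
    EqModP p (x - x') (y - y') := by
  have := h₁.add h₂.neg; simpa [sub_eq_add_neg] using this

/-- `≡ (mod p)` respects multiplication by a `p`-integral rational. -/
theorem EqModP.mul_left {c x y : ℚ} (hc : padicNorm p c ≤ 1) (h : EqModP p x y) :
    EqModP p (c * x) (c * y) := by
  unfold EqModP at *
  rw [← mul_sub, padicNorm.mul]
  calc padicNorm p c * padicNorm p (x - y) ≤ 1 * (p : ℚ)⁻¹ :=
        mul_le_mul hc h (padicNorm.nonneg _) zero_le_one
    _ = (p : ℚ)⁻¹ := one_mul _

/-- `≡ (mod p)` respects division by `2` (`p` odd). -/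
theorem EqModP.div_two (h2 : p ≠ 2) {x y : ℚ} (h : EqModP p x y) : EqModP p (x / 2) (y / 2) := by
  have h2n : padicNorm p (1 / 2 : ℚ) ≤ 1 := by
    rw [padicNorm.div, show padicNorm p (2 : ℚ) = 1 by
      simpa using padicNorm.padicNorm_of_prime_of_ne (p := p) (q := 2) h2]; simp
  have := h.mul_left h2n
  have e : ∀ z : ℚ, (1 / 2 : ℚ) * z = z / 2 := fun z => by ring
  rwa [e, e] at this

/-- `≡ (mod p)` respects finite sums. -/
theorem EqModP.sum {ι : Type*} {s : Finset ι} {f g : ι → ℚ} (h : ∀ i ∈ s, EqModP p (f i) (g i)) :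
    EqModP p (∑ i ∈ s, f i) (∑ i ∈ s, g i) := by
  unfold EqModP at *
  rw [← sum_sub_distrib]
  exact padicNorm.sum_le' h (by positivity)

/-- **Key lemma.**  If `‖B_j‖_p ≤ p` and `w_j ≡ w'_j (mod p)` for all `j ∈ s`, then
`Σ_j B_j w_j − Σ_j B_j w'_j` is `p`-integral. -/
theorem padicNorm_sum_mul_sub_le_one {ι : Type*} {s : Finset ι} {B w w' : ι → ℚ}
    (hB : ∀ j ∈ s, padicNorm p (B j) ≤ p) (hw : ∀ j ∈ s, EqModP p (w j) (w' j)) :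
    padicNorm p (∑ j ∈ s, B j * w j - ∑ j ∈ s, B j * w' j) ≤ 1 := by
  rw [← sum_sub_distrib]
  refine padicNorm.sum_le' (fun j hj => ?_) zero_le_one
  rw [← mul_sub, padicNorm.mul]
  have hp0 : (p : ℚ) ≠ 0 := by exact_mod_cast hp.out.ne_zero
  calc padicNorm p (B j) * padicNorm p (w j - w' j) ≤ p * (p : ℚ)⁻¹ :=
        mul_le_mul (hB j hj) (hw j hj) (padicNorm.nonneg _) (by positivity)
    _ = 1 := mul_inv_cancel₀ hp0

/-- `‖2‖_p = 1` for odd `p` (file-local copy; the public statement is the tree's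
`SecondOrder.padicNorm_two` — kept private here to avoid a `dedup.landed` twin; lane edit lead/lit g13). -/
private theorem padicNorm_two_eq_one (h2 : p ≠ 2) : padicNorm p (2 : ℚ) = 1 := by
  simpa using padicNorm.padicNorm_of_prime_of_ne (p := p) (q := 2) h2

omit hp in
/-- `p ∤ e` for a nonzero integer with `|e| < p`. -/
theorem not_dvd_of_natAbs_lt {e : ℤ} (he0 : e ≠ 0) (he : e.natAbs < p) : ¬ (p : ℤ) ∣ e := by
  intro hd
  have : p ≤ e.natAbs := Nat.le_of_dvd (Int.natAbs_pos.2 he0)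
    (by have := Int.natAbs_dvd_natAbs.2 hd; simpa using this)
  omega

/-- `p ∤ 2d` for odd `p` and `0 < |d| < p`. -/
theorem not_dvd_two_mul (h2 : p ≠ 2) {d : ℤ} (hd0 : d ≠ 0) (hd : d.natAbs < p) :
    ¬ (p : ℤ) ∣ 2 * d := by
  intro h
  have hpr : Prime (p : ℤ) := Nat.prime_iff_prime_int.1 hp.out
  rcases hpr.dvd_or_dvd h with h | h
  · have h' : p ∣ 2 := by exact_mod_cast h
    exact h2 ((Nat.prime_dvd_prime_iff_eq hp.out Nat.prime_two).1 h')
  · exact not_dvd_of_natAbs_lt hd0 hd h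

/-- **Unit shift**: `1/(p + e) ≡ 1/e (mod p)` for an integer `e` prime to `p`. -/
theorem inv_p_add_modP {e : ℤ} (he : ¬ (p : ℤ) ∣ e) : EqModP p (1 / ((p : ℚ) + e)) (1 / (e : ℚ)) := by
  have he0' : e ≠ 0 := by rintro rfl; exact he (dvd_zero _)
  have he0 : (e : ℚ) ≠ 0 := by exact_mod_cast he0'
  have hpe : ¬ (p : ℤ) ∣ (p : ℤ) + e := fun h => he (by simpa using dvd_sub h (dvd_refl (p : ℤ)))
  have hpe0' : (p : ℤ) + e ≠ 0 := by intro h; exact hpe (h ▸ dvd_zero _)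
  have hpe0 : ((p : ℚ) + e) ≠ 0 := by exact_mod_cast hpe0'
  unfold EqModP
  have e1 : 1 / ((p : ℚ) + e) - 1 / (e : ℚ) = -((p : ℚ) / ((((p : ℤ) + e : ℤ) : ℚ) * e)) := by
    push_cast; field_simp; ring
  rw [e1, padicNorm.neg, padicNorm.div, padicNorm.padicNorm_p_of_prime, padicNorm.mul,
    (padicNorm.int_eq_one_iff _).2 hpe, (padicNorm.int_eq_one_iff _).2 he, mul_one, div_one]

/-- **Half-integer unit shift**: `2/(p + 2d) ≡ 1/d (mod p)` for odd `p` and `0 < |d| < p`. -/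
theorem two_div_p_add_modP (h2 : p ≠ 2) {d : ℤ} (hd0 : d ≠ 0) (hd : d.natAbs < p) :
    EqModP p (2 / ((p : ℚ) + 2 * d)) (1 / (d : ℚ)) := by
  have h1 := inv_p_add_modP (p := p) (not_dvd_two_mul h2 hd0 hd)
  have h3 := h1.mul_left (padicNorm_two_eq_one h2).le
  have hd0' : (d : ℚ) ≠ 0 := by exact_mod_cast hd0
  have e1 : (2 : ℚ) * (1 / ((p : ℚ) + ((2 * d : ℤ) : ℚ))) = 2 / ((p : ℚ) + 2 * d) := by
    push_cast; ring
  have e2 : (2 : ℚ) * (1 / (((2 * d : ℤ) : ℚ))) = 1 / (d : ℚ) := by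
    push_cast; field_simp
  rwa [e1, e2] at h3

end Summit.KontsevichZagierPeriods.Zeta5Search.Denom.WindowModP
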